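import Mathlib
import Summits.Ventures.PercRepro2.A3CutCrossShield
import Summits.Ventures.PercRepro2.HCovSwap

/-!
# The cross-shield, mirrored under the root swap: `x` separating `{a₂, o}` from `{a₁, b}`
(blind cell PercRepro2, night-1 g33; proofs/NIGHT1-G33.md §7)

`btw`, (MEANS-a₃) and (HCOV) are symmetric in the two roots (the cell's `btw_swap`, `A3Between_swap`,
`HCov_swap`), so the cross-shield identity `btw_cross` (the root `a₁` with `o` behind the cut vertex `x`,
the root `a₂` with `b` in front) also covers the root `a₂` with `o` behind `x` and `a₁` with `b` in front
(`btw_cross_mirror`, `A3Between_cross_mirror`, `HCov_cross_mirror`); the two sides of the cut may be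
exchanged by `IsCut.symm`.  Standard axioms.
-/

namespace Summit.Ventures.PercRepro2

open UnionCluster CovForm CutV

namespace CovForm

namespace A3Fibre

namespace CrossShield

section Mirror

variable {V : Type*} {E : Type*} [Fintype V] [DecidableEq V] [Fintype E] [DecidableEq E]
  {R : Type*} [Field R] [LinearOrder R] [IsStrictOrderedRing R] {ends : E → Sym2 V} {x : V}
  {VA VB : Finset V} {EA EB : Set E} [DecidablePred (· ∈ EA)] [DecidablePred (· ∈ EB)] {p : E → R}
  {a₁ a₂ o b : V}

/-- **The cross-shield identity, mirrored**: `btw(x) = 0` when `x` separates `{a₂, o}` from `{a₁, b}`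
and `P(PD_x) ≠ 0`. -/
theorem btw_cross_mirror (hp : IsProbVec p) (h : IsCut ends x ↑VA ↑VB EA EB) (ha2 : a₂ ∈ VA)
    (ho : o ∈ VA) (ha1 : a₁ ∈ insert x VB) (hb : b ∈ insert x VB)
    (hD : prob p (PDEvent ends a₁ a₂ x) ≠ 0) : btw p ends o a₁ a₂ x b = 0 := by
  rw [← btw_swap]
  rw [← PDEvent_swap] at hD
  exact btw_cross hp h ha2 ho ha1 hb hD

/-- (MEANS-a₃) at `x` with `{a₂, o}` behind it, unconditionally. -/
theorem A3Between_cross_mirror (hp : IsProbVec p) (h : IsCut ends x ↑VA ↑VB EA EB) (ha2 : a₂ ∈ VA)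
    (ho : o ∈ VA) (ha1 : a₁ ∈ insert x VB) (hb : b ∈ insert x VB) :
    A3Between p ends o a₁ a₂ x b :=
  (A3Between_swap p ends o a₁ a₂ x b).1 (A3Between_cross hp h ha2 ho ha1 hb)

/-- (HCOV) at `x` with `{a₂, o}` behind it. -/
theorem HCov_cross_mirror (hp : IsProbVec p) (h : IsCut ends x ↑VA ↑VB EA EB) (ha2 : a₂ ∈ VA)
    (ho : o ∈ VA) (ha1 : a₁ ∈ insert x VB) (hb : b ∈ insert x VB) : HCov p ends o a₁ a₂ x b :=
  HCov_of_a3Between hp ends o a₁ a₂ x b (A3Between_cross_mirror hp h ha2 ho ha1 hb)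

end Mirror

end CrossShield

end A3Fibre

end CovForm

end Summit.Ventures.PercRepro2
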